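import Literature.NumberTheory.EllipticCurves.CMTorsionGaloisImageHoldsProofs
import HarnessLib

/-!
# Crux U `EllipticGluingPrimeBound` (stmt-ABC-13919), line `Sketch`: the CM input is DISCHARGED

Registered stub `stub_cmTorsionCartanImage` of the line's skeleton
(`Cruxes/EllipticGluingPrimeBound/Lines/Sketch.lean`, v13): the named fact
`Literature.NumberTheory.EllipticCurves.cmTorsion_cartanImage` — the main theorem of complex
multiplication read on the `ℓ`-torsion of the thirteen CM curves over `ℚ` (Lang, *Elliptic
Functions*, Ch. 10 §4, Remark and Thm. 8): `φ = [√D]` on `W[ℓ]`, its quadratic twist `χ_K`, and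
the Cartan image of `Γ_K` up to `12`-th powers, beyond an absolute threshold `L₀`.

The fact has meanwhile been PROVED in the tree by the literature programme
(`Literature.NumberTheory.EllipticCurves.cmTorsion_cartanImage_holds`,
`CMTorsionGaloisImageHoldsProofs.lean`: Serre 1972 §1.11/§4.5 in place of Lang's idelic
argument — supersingular and ordinary inertia at a good prime `ℓ`, complex conjugation, twisting
cocycles of exponent `12`, maximum over the thirteen `j`-invariants; standard axioms only).
This file closes the stub by that theorem, so the CM isotypic core of the line
(`stub_CMTorsionCoreOf` p112893, `stub_CMIsotypicCoreOf` p115225) and the irreducibility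
threshold (`stub_irreducibleThreshold` p117030) no longer rest on an unproved CM input.

Lands `--supports stmt-ABC-13919`. No definitions; no `sorry`.
-/

noncomputable section

-- `Summit.<Summit>.<Problem>` is the mandated summit-side namespace (CONVENTIONS §2); for the
-- single-conjunct summit `ABC` the two coincide, so the duplicate `ABC.ABC` is deliberate.
set_option linter.dupNamespace false

namespace Summit.ABC.ABC.Theorems.IsotypicMinkowski

/-- **Registered stub `stub_cmTorsionCartanImage`, closed**: the CM torsion fact
`cmTorsion_cartanImage` (Lang 1987, Ch. 10 §4, Thm. 8 on `ℓ`-torsion over `ℚ`) holds — by the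
tree's discharge `cmTorsion_cartanImage_holds`. -/
theorem stub_cmTorsionCartanImage :
    Literature.NumberTheory.EllipticCurves.cmTorsion_cartanImage :=
  Literature.NumberTheory.EllipticCurves.cmTorsion_cartanImage_holds

end Summit.ABC.ABC.Theorems.IsotypicMinkowski

end
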